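import Mathlib
import Literature.AlgebraicGeometry.Resolution.CutkoskySurfaceOmega
import HarnessLib

/-!
# Cutkosky 2009, Theorem 10.18: `Ω` drops along the `τ = 1` sequence (named fact)

Topic: `Literature/AlgebraicGeometry/Resolution`.  S. D. Cutkosky, *Resolution of singularities for
3-folds in positive characteristic*, Amer. J. Math. **131** (2009) 59–127 [cite: Cutkosky2009], §10.5
"Construction of the sequence `Ω(q_n)`", p. 36 l. 55–72:

> **Theorem 10.18.** For all `n ∈ ℕ`, there are good parameters `(x_n, y_n, z_n)` for
> `I_n = (𝓘_n)_{q_n} R_n` in `R_n` such that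
> `Ω(I_{n+1}; x_{n+1}, y_{n+1}, z_{n+1}) = (β_{n+1}, 1/ε_{n+1}, α_{n+1}) < Ω(I_n; x_n, y_n, z_n) = (β_n, 1/ε_n, α_n)`.
> Further, if `β_{n+1} = β_n`, `ε_{n+1} ≠ ε_n` and `1/ε_n ≠ ∞`, then `1/ε_{n+1} = 1/ε_n − 1`.

followed (p. 37 l. 78–80) by "We now prove that (11) cannot have infinite length. Set
`Ω(q_n) = Ω(I_n; x_n, y_n, z_n)` for `n ∈ ℕ`. By Theorem 10.18, we have a contradiction if (11) has
infinite length, as the sequence `Ω(q_n)` cannot decrease indefinitely" (the last clause is PROVED in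
`CutkoskySurfaceOmega.lean`: `Cutkosky2009.no_infinite_descent`).

## The context of (11) carried by the chain datum `Cutkosky2009.TauOneChain`

(11) (p. 25 l. 20–40): "Assume that (10) is not finite. We must then have an infinite sequence of points
`q_n ∈ V_n` such that `q_n ∈ Sing_r(I_n)`, and `q_n` maps to `q_{n−1}` for all `n`. … we may assume
that `τ(q_n) = τ(q)` for all `n`. … We have a sequence `R_0 → R_1 → ⋯` (11) of infinite length, where
`R_i = 𝒪̂_{V_i,q_i}` is the completion of the local ring of `V_i` at `q_i`, and `ν_{q_i}(I_i) = r` for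
all `i`. Let `I_i = (𝓘_i)_{q_i} R_i`. … `τ(q_n) = τ(I_n)` for all `n`"; §10 is the case `τ(q) = 1`;
`V` is a nonsingular 3-fold over an ALGEBRAICALLY CLOSED field `k` of arbitrary characteristic (§5
p. 17 l. 9–10), so every `R_n ≅ k⟦x, y, z⟧` (modelled as ONE ring `T = MvPowerSeries (Fin 3) k`); the
blow-ups follow the algorithm (10) (p. 24 l. 42–45: "1. If there is a curve in `Sing_r(I_n)`, then blow
up the union of one dimensional components of `Sing_r(I_n)`. 2. Otherwise, blow up `Sing_r(I_n)`, which
is a finite union of points"), under which "`Sing_r(I_n)` is always a disjoint union of points and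
nonsingular curves" (p. 24 l. 46–48), with "`Sing_r(I_n) ∩ Spec(R_n) = Sing_r(Î_n)`" (p. 25 l. 35) and
"By our reduction in Section 8, `q` is isolated in `Sing_r(I)`" (p. 36 l. 81).  Locally at `q_n` a
step of (11) is therefore (Lemma 5.1, Def. 10.10 p. 31 l. 36 – p. 32 l. 4: "`T_1` is the completion of
the local ring of a blow up of `T`", types Tr1–Tr4 with "`I_1 = (1/x_1^r) I T_1` is the weak transform
of `I` in `T_1`") the completed local ring, at a closed point `q_{n+1} ∈ Sing_r(I_{n+1})` over `q_n`,
of the blow-up of `Spec R_n` along THE nonsingular curve of `Sing_r(I_n)` through `q_n` if there is one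
(curve step) and at `q_n` otherwise (point step) — the case analysis of the printed proof, p. 36 l. 84 –
p. 37 l. 13; stages of (10) whose centre misses `q_n` do not change `R_n` and are not terms of (11).
Since `k = k̄`, every closed point of an exceptional fibre is `k`-rational and becomes the ORIGIN of the
first chart after a linear change of the regular system of parameters adapted to the centre, so the two
chart shapes `IsPointStep` / `IsCurveStep` below (origin of the `u 0`-chart; the tree's shapes of
`PolygonChartTransport` / `CurveBlowupPolygonLaws`) cover all steps.  NOT carried: the divisors
`E_n^±` of Def. 5.4 / Thm. 7.2 (transversality bookkeeping), which §10 does not use.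

Invariants (§5 p. 17, §10.2 p. 28): `ν_R(I)` = "the largest integer `n` such that `I ⊂ M(R)^n`"
(p. 14 l. 44–45) — `HasOrder`; `Sing_t(I) = {p | ν_p(I) ≥ t}` (p. 17 l. 13) — `InSingR` (at a prime
`P`: `I R_P ⊆ P^r R_P`); `τ(I) = 1` — "the dimension of the smallest linear subspace `T` … such that
`L ∈ k[T]` for all `f ∈ I`" equals `1` (p. 17 l. 35–38), i.e. all `r`-leading forms are multiples of
`ℓ^r` for one linear form `ℓ` — `TauOne`; GOOD parameters: "`(x, y, z)` will be called good parameters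
for `I` if `ν_T(I) = r` and `b_{00r} ≠ 0` for all `g ∈ I` such that `ν_T(g) = r`" (p. 28 l. 65–66),
i.e. `z^r` occurs in every `g ∈ I` of order `r` — `IsGood` (dictionary `z ↔ c 0`, `x ↔ c 1`, `y ↔ c 2`
of `CutkoskySurfaceOmega.lean`).  Expansion-free renderings; `T` is Noetherian so they are the printed
notions.

## Scope (honest)

The theorem is printed for the sequence (11) of the resolution algorithm; its proof (§10.5 p. 36 l. 74 –
p. 37 l. 75, assembling Lemmas 10.13–10.17 and Thm. 10.17, all stated for ideals of a power series ring
`T` and `T_1` "the completion of the local ring of a blow up of `T`", Def. 10.10) uses of (11) exactly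
the properties recorded in `TauOneChain`.  The typed fact quantifies over all such chains.  The
STEP-LOCAL reading ("apply 10.18 to one step, also off the sequence") is NOT this fact.  Statement
only; NOT proved here (one future discharge `Cutkosky2009_Thm10_18_holds`).  AI transcription of the
text layer of the held copy `paper:doi-10-1353-ajm-0-0036` (formula glyphs re-read in context: the
dropped letter in "if `β_{n+1} = β_n`, `_{n+1} ≠ _n` and `1/_n ≠ ∞`" is `ε`, as in the proof p. 37
l. 64–69 "If `β_{n+1} = β_n`, and `ε_n ≠ 0`, then `1/ε_{n+1} = 1/ε_n − 1`"); weaker than expert review.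

## Sources

* S. D. Cutkosky, Amer. J. Math. 131 (2009): §5 p. 17; (10) p. 24; (11) p. 25; §10.1–10.2 p. 28;
  Def. 10.10 pp. 31–32; Thm. 10.18 p. 36 l. 55–72 and its proof to p. 37 l. 80. [Cutkosky2009]
-/

noncomputable section

open IsLocalRing

namespace Literature.AlgebraicGeometry.Resolution.Cutkosky2009

universe u

/-! ## Expansion-free local notions in a local ring -/
section Local
variable {R : Type u} [CommRing R] [IsLocalRing R]

/-- `(c 0, c 1, c 2)` are regular parameters: they generate the maximal ideal (in `k⟦x, y, z⟧` every
such triple is a regular system of parameters). [cite: Cutkosky2009, §10.1 p. 28 l. 10] -/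
def IsParams (c : Fin 3 → R) : Prop := Ideal.span {c 0, c 1, c 2} = maximalIdeal R

/-- `ν_R(I) = r`: "`ν_R(I)` is defined to be the largest integer `n` such that `I ⊂ M(R)^n`".
[cite: Cutkosky2009, §4 p. 14 l. 44–45] -/
def HasOrder (I : Ideal R) (r : ℕ) : Prop := I ≤ maximalIdeal R ^ r ∧ ¬ I ≤ maximalIdeal R ^ (r + 1)

/-- `P ∈ Sing_r(I)`, i.e. `ν_P(I) ≥ r`: `I R_P ⊆ P^r R_P`, written without localisation as "every
`g ∈ I` is thrown into `P^r` by an element outside `P`". [cite: Cutkosky2009, §5 p. 17 l. 13] -/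
def InSingR (I : Ideal R) (r : ℕ) (P : Ideal R) : Prop :=
  P.IsPrime ∧ ∀ g ∈ I, ∃ s : R, s ∉ P ∧ s * g ∈ P ^ r

/-- `τ(I) = 1` for an ideal of order `r ≥ 1`: all `r`-leading forms of elements of `I` are multiples of
`ℓ^r` for ONE linear form `ℓ` ("the dimension of the smallest linear subspace `T` … such that
`L ∈ k[T]` for all `f ∈ I`" is `1`), expansion-free: `I ⊆ (ℓ^r) + 𝔪^{r+1}` with `ℓ ∈ 𝔪 ∖ 𝔪²`.
[cite: Cutkosky2009, §5 p. 17 l. 29–38] -/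
def TauOne (I : Ideal R) (r : ℕ) : Prop :=
  ∃ ℓ : R, ℓ ∈ maximalIdeal R ∧ ℓ ∉ maximalIdeal R ^ 2 ∧
    I ≤ Ideal.span {ℓ ^ r} ⊔ maximalIdeal R ^ (r + 1)

/-- GOOD parameters `c = (z, x, y)` for `I` with `ν(I) = r`: "`b_{00r} ≠ 0` for all `g ∈ I` such that
`ν_T(g) = r`", i.e. the monomial `z^r = (c 0)^r` occurs in every element of `I` of order exactly `r`
(expansion-free: `g ∉ (c 1, c 2) + 𝔪^{r+1}`). [cite: Cutkosky2009, §10.2 p. 28 l. 65–66] -/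
def IsGood (c : Fin 3 → R) (I : Ideal R) (r : ℕ) : Prop :=
  IsParams c ∧ HasOrder I r ∧
    ∀ g ∈ I, g ∉ maximalIdeal R ^ (r + 1) → g ∉ Ideal.span {c 1, c 2} ⊔ maximalIdeal R ^ (r + 1)

/-- A nonsingular curve germ through the closed point: a prime generated by two members of a regular
system of parameters. [cite: Cutkosky2009, §8 p. 24 l. 46–48] -/
def IsRegularCurveGerm (P : Ideal R) : Prop := ∃ u : Fin 3 → R, IsParams u ∧ P = Ideal.span {u 0, u 1}

end Local

/-! ## The steps of (11): completed local rings of blow-ups (Def. 10.10) -/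
section Steps
variable {k : Type u} [Field k]

/-- POINT step `R_n → R_{n+1}` (centre the closed point; Tr1/Tr2 of Def. 10.10 up to the choice of
parameters): for regular parameters `u` of `R_n` and `u'` of `R_{n+1}` — chosen so that the closed point
`q_{n+1}` of the exceptional plane is the origin of the `u 0`-chart — `φ` is the `k`-algebra map with
`u 0 ↦ u' 0`, `u 1 ↦ u' 0 · u' 1`, `u 2 ↦ u' 0 · u' 2`, and `I' = (1/(u' 0)^r) · I R_{n+1}` is the weak
transform. [cite: Cutkosky2009, Def. 10.10 p. 31 l. 36 – p. 32 l. 4] -/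
def IsPointStep (I I' : Ideal (MvPowerSeries (Fin 3) k))
    (φ : MvPowerSeries (Fin 3) k →ₐ[k] MvPowerSeries (Fin 3) k) (r : ℕ) : Prop :=
  ∃ u u' : Fin 3 → MvPowerSeries (Fin 3) k, IsParams u ∧ IsParams u' ∧
    φ (u 0) = u' 0 ∧ φ (u 1) = u' 0 * u' 1 ∧ φ (u 2) = u' 0 * u' 2 ∧
    I.map φ ≤ Ideal.span {u' 0 ^ r} ∧ I' = (I.map φ).colon (Ideal.span {u' 0 ^ r})

/-- CURVE step `R_n → R_{n+1}` along the nonsingular curve germ `V(P)`, `P = (u 0, u 1)` (Tr3/Tr4 of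
Def. 10.10 up to the choice of parameters; `q_{n+1}` the origin of the `u 0`-chart): `φ` is the
`k`-algebra map with `u 0 ↦ u' 0`, `u 1 ↦ u' 0 · u' 1`, `u 2 ↦ u' 2`, and `I' = (1/(u' 0)^r) · I R_{n+1}`.
[cite: Cutkosky2009, Def. 10.10 p. 31 l. 36 – p. 32 l. 4] -/
def IsCurveStep (I I' : Ideal (MvPowerSeries (Fin 3) k))
    (φ : MvPowerSeries (Fin 3) k →ₐ[k] MvPowerSeries (Fin 3) k) (r : ℕ)
    (P : Ideal (MvPowerSeries (Fin 3) k)) : Prop :=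
  ∃ u u' : Fin 3 → MvPowerSeries (Fin 3) k, IsParams u ∧ IsParams u' ∧ P = Ideal.span {u 0, u 1} ∧
    φ (u 0) = u' 0 ∧ φ (u 1) = u' 0 * u' 1 ∧ φ (u 2) = u' 2 ∧
    I.map φ ≤ Ideal.span {u' 0 ^ r} ∧ I' = (I.map φ).colon (Ideal.span {u' 0 ^ r})

variable (k)

/-- **The sequence (11) in the case `τ(q) = 1`** (the context of Theorem 10.18), over an algebraically
closed field `k`, all rings `R_n = k⟦x, y, z⟧`: ideals `I n` of order exactly `r ≥ 1` ("`ν_{q_i}(I_i) = r`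
for all `i`") with `τ(I_n) = 1`; `Sing_r(I_n)` near `q_n` is `{q_n}` or `{q_n} ∪` ONE nonsingular curve
germ ("disjoint union of points and nonsingular curves"); `q_0` isolated in `Sing_r(I_0)` (§8); and each
`R_n → R_{n+1}` is, by the algorithm (10), the curve step along the curve of `Sing_r(I_n)` through `q_n`
when there is one and the point step otherwise, ending at a point `q_{n+1}` of `Sing_r(I_{n+1})`.
[cite: Cutkosky2009, (11) p. 25 l. 20–40; (10) p. 24 l. 42–48; p. 36 l. 81] -/
structure TauOneChain [IsAlgClosed k] (r : ℕ) where
  /-- the ideals `I_n = (𝓘_n)_{q_n} R_n` -/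
  I : ℕ → Ideal (MvPowerSeries (Fin 3) k)
  /-- the maps `R_n → R_{n+1}` of completed local rings -/
  φ : ℕ → (MvPowerSeries (Fin 3) k →ₐ[k] MvPowerSeries (Fin 3) k)
  /-- `r ≥ 1` (`q_n` is a singular point of order `r = max ν`) -/
  one_le : 1 ≤ r
  /-- "`ν_{q_i}(I_i) = r` for all `i`" (p. 25 l. 34) -/
  hasOrder : ∀ n, HasOrder (I n) r
  /-- "`τ(q_n) = τ(I_n)`" `= τ(q) = 1` for all `n` (p. 25 l. 22–23, l. 36–37; §10) -/
  tauOne : ∀ n, TauOne (I n) r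
  /-- "By our reduction in Section 8, `q` is isolated in `Sing_r(I)`" (p. 36 l. 81) -/
  isolated_zero : ∀ P, P ≠ maximalIdeal _ → ¬ InSingR (I 0) r P
  /-- "`Sing_r(I_n)` is always a disjoint union of points and nonsingular curves" (p. 24 l. 46–48),
  locally at `q_n`: a non-closed point of `Sing_r(I_n)` is a nonsingular curve germ … -/
  singR_curve : ∀ n P, P ≠ maximalIdeal _ → InSingR (I n) r P → IsRegularCurveGerm P
  /-- … and there is at most one of them ("disjoint") -/
  singR_unique : ∀ n P P', P ≠ maximalIdeal _ → P' ≠ maximalIdeal _ →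
    InSingR (I n) r P → InSingR (I n) r P' → P = P'
  /-- the step `R_n → R_{n+1}` under the algorithm (10): along the curve of `Sing_r(I_n)` through `q_n`
  if there is one, else at the point `q_n` (p. 24 l. 42–45; proof of Thm. 10.18 p. 36 l. 84 – p. 37 l. 13) -/
  step : ∀ n, (∃ P, P ≠ maximalIdeal _ ∧ InSingR (I n) r P ∧ IsCurveStep (I n) (I (n + 1)) (φ n) r P) ∨
    ((∀ P, P ≠ maximalIdeal _ → ¬ InSingR (I n) r P) ∧ IsPointStep (I n) (I (n + 1)) (φ n) r)

end Steps

/-! ## The named fact -/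

/-- **Cutkosky 2009, Theorem 10.18** (named fact, statement only): along every sequence (11) with
`τ(q) = 1` — a `TauOneChain` over an algebraically closed field `k` of any characteristic — "For all
`n ∈ ℕ`, there are good parameters `(x_n, y_n, z_n)` for `I_n` … in `R_n` such that
`Ω(I_{n+1}; x_{n+1}, y_{n+1}, z_{n+1}) = (β_{n+1}, 1/ε_{n+1}, α_{n+1}) < Ω(I_n; x_n, y_n, z_n) = (β_n, 1/ε_n, α_n)`.
Further, if `β_{n+1} = β_n`, `ε_{n+1} ≠ ε_n` and `1/ε_n ≠ ∞`, then `1/ε_{n+1} = 1/ε_n − 1`."  Here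
`Ω`, `β`, `ε`, `1/ε` are `Cutkosky2009.OmegaCu / betaS / epsCu / invEpsCu` of `CutkoskySurfaceOmega.lean`
in the good parameters `c n = (z_n, x_n, y_n)` with `μ = r` (the constant scale `L = r!` changes no
comparison).  With `Cutkosky2009.no_infinite_descent` it yields that (11) is finite (p. 37 l. 78–80).
NOT the step-local reading; NOT proved here.  [cite: Cutkosky2009, Thm. 10.18 p. 36 l. 55–72] -/
def _root_.Literature.AlgebraicGeometry.Resolution.Cutkosky2009_Thm10_18 : Prop :=
  ∀ (k : Type) [Field k] [IsAlgClosed k] (r : ℕ) (C : TauOneChain k r),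
    ∃ c : ℕ → (Fin 3 → MvPowerSeries (Fin 3) k),
      (∀ n, IsGood (c n) (C.I n) r) ∧
      ∀ n, OmegaCu (c (n + 1)) (C.I (n + 1)) r < OmegaCu (c n) (C.I n) r ∧
        (betaS (c (n + 1)) (C.I (n + 1)) r = betaS (c n) (C.I n) r →
          epsCu (c (n + 1)) (C.I (n + 1)) r ≠ epsCu (c n) (C.I n) r →
            invEpsCu (c n) (C.I n) r ≠ ⊤ →
              invEpsCu (c (n + 1)) (C.I (n + 1)) r + 1 = invEpsCu (c n) (C.I n) r)

/-- Unfolding: under the named fact, the `Ω`-values along any `τ = 1` chain obey the step law `CuStep`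
at every step — which `Cutkosky2009.no_infinite_descent` forbids for an infinite chain; so the fact
implies that NO `TauOneChain` exists ("(11) cannot have infinite length").
[cite: Cutkosky2009, p. 37 l. 78–80] -/
theorem isEmpty_tauOneChain_of (h : Cutkosky2009_Thm10_18) (k : Type) [Field k] [IsAlgClosed k]
    (r : ℕ) : IsEmpty (TauOneChain k r) := by
  refine ⟨fun C => ?_⟩
  obtain ⟨c, -, hstep⟩ := h k r C
  exact no_infinite_descent (fun n => OmegaCu (c n) (C.I n) r)
    (fun n => cuStep_OmegaCu (hstep n).1 (hstep n).2)

end Literature.AlgebraicGeometry.Resolution.Cutkosky2009
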